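import Literature.Analysis.FluidPDE.PeriodicCylinderQuadraticFormBounds
import Literature.Analysis.FluidPDE.PeriodicCylinderProjectorBounds
import Literature.Analysis.FluidPDE.Ferrari1993PressureEstimateData
import HarnessLib

/-!
# Kato–Lai's nonlinear operator in the periodic cylinder, cell side: the Leray part, the
# convective term and the tame pressure estimate

Analysis/FluidPDE support file for the energy-method construction of Euler flows in the
periodic cylinder (`Literature.Analysis.FluidPDE.KatoLai1984_periodicCylinderUniformExistence`;
Kato–Lai 1984, §5 (5.6): `A(u) = F(Pu, u) − QF(Pu, Pu)`, with §4 (i) `P`, `Q` bounded on `H^s`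
and (4.4) `‖QF(u, v)‖_s ≤ c(‖u‖_{s₀}‖v‖_s + ‖u‖_s‖v‖_{s₀})`). For a field `u`, `C^∞` on the closed
cylinder `{r ≤ 1}` and `L`-periodic in `z` (`IsSmoothPeriodic L u`):

* `lerayPot`, `lerayPart` — the potential `q̂` and the Leray part `w = P u = u − ∇_K q̂` of the
  smooth Helmholtz decomposition (`exists_smooth_leray_decomposition`), smooth periodic,
  divergence free in the open cylinder, tangential on the wall, with the `H^k` bounds of
  Kato–Lai's §4 (i) for every `k ≥ 1` (`exists_leray_bound`, the proof of
  `exists_helmholtz_leray_bound` for this choice);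
* `convTerm = (w·∇_K)w` — the convective term (smooth periodic), `pressurePot`, `pressureGrad` —
  the potential `π` and the gradient part `∇_K π = Q((w·∇_K)w)` of its decomposition; its
  Neumann problem: `Δ_K π = ∑ᵢⱼ (∂ᵢw)ⱼ(∂ⱼw)ᵢ` in the open cylinder and `∂π/∂n = −|w_h|²` on the
  wall (`cylLap_pressurePot_eq`, `neumann_pressurePot_eq`);
* `exists_pressureGrad_le` — **the tame pressure estimate**: for `L > 0` and `m ≥ 1` there is
  `C` with `‖∇_K π‖_{W^{m,2}(cell)} ≤ C ‖u‖_{W^{3,2}(cell)} ‖u‖_{W^{m,2}(cell)}` for all such `u`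
  (all-orders Neumann estimate `periodicCylinder_neumannEstimate_all` fed with the tame bounds of
  `PeriodicCylinderQuadraticFormBounds`).

Everything is proved; no named fact and no `sorry` is introduced.

## References

* T. Kato, C. Y. Lai, J. Funct. Anal. 56 (1984) 15–28, §4 (i), (4.4), §5 (5.6). [KatoLai1984]
* R. Temam, J. Funct. Anal. 20 (1975) 32–43, §1. [Temam1975]
-/

noncomputable section

open MeasureTheory Set Function Filter Topology TopologicalSpace WithLp Finset
open scoped ContDiff NNReal ENNReal InnerProductSpace RealInnerProductSpace Laplacian

namespace Literature.Analysis.FluidPDE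

open FunctionSpaces

/-- Local notation for physical space `ℝ³ = EuclideanSpace ℝ (Fin 3)`. -/
local notation "ℝ³" => EuclideanSpace ℝ (Fin 3)

/-- Local notation for the closed cylinder `{r ≤ 1}`. -/
local notation "𝕂" => closure (SetLike.coe unitCylinder : Set (EuclideanSpace ℝ (Fin 3)))

namespace PeriodicCylinder

variable {L : ℝ}

/-! ### The Leray part -/

section Leray

variable (hL : 0 < L) {u : ℝ³ → ℝ³} (hu : IsSmoothPeriodic L u)

/-- **The potential `q̂` of the smooth Helmholtz decomposition** `u = P u + ∇_K q̂`. [cite: KatoLai1984, §4 (i)] -/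
def lerayPot : ℝ³ → ℝ := Classical.choose (exists_smooth_leray_decomposition hL hu)

/-- The defining properties of `lerayPot`. [folklore] -/
theorem lerayPot_spec :
    IsSmoothPeriodic L (lerayPot hL hu) ∧
      helmholtzProj L (toCell L u) = toCell L (cylGrad (lerayPot hL hu)) ∧
      lerayProj L (toCell L u) = toCell L (fun x => u x - cylGrad (lerayPot hL hu) x) ∧
      IsSmoothPeriodic L (fun x => u x - cylGrad (lerayPot hL hu) x) ∧
      (∀ x ∈ (unitCylinder : Set ℝ³), VectorCalculus.divergence (fun y => u y - cylGrad (lerayPot hL hu) y) x = 0) ∧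
      (∀ x ∈ frontier (unitCylinder : Set ℝ³), ⟪u x - cylGrad (lerayPot hL hu) x, eR x⟫ = 0) :=
  Classical.choose_spec (exists_smooth_leray_decomposition hL hu)

/-- **The Leray part** `w = P u = u − ∇_K q̂`. [cite: KatoLai1984, §4 (i)] -/
def lerayPart : ℝ³ → ℝ³ := fun x => u x - cylGrad (lerayPot hL hu) x

/-- The potential is smooth periodic. [folklore] -/
theorem isSmoothPeriodic_lerayPot : IsSmoothPeriodic L (lerayPot hL hu) := (lerayPot_spec hL hu).1

/-- The Leray part is smooth periodic. [folklore] -/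
theorem isSmoothPeriodic_lerayPart : IsSmoothPeriodic L (lerayPart hL hu) := (lerayPot_spec hL hu).2.2.2.1

/-- The Leray part is divergence free in the open cylinder. [folklore] -/
theorem divergence_lerayPart : ∀ x ∈ (unitCylinder : Set ℝ³), VectorCalculus.divergence (lerayPart hL hu) x = 0 :=
  (lerayPot_spec hL hu).2.2.2.2.1

/-- The Leray part is tangential on the wall. [folklore] -/
theorem slip_lerayPart : ∀ x ∈ frontier (unitCylinder : Set ℝ³), ⟪lerayPart hL hu x, eR x⟫ = 0 :=
  (lerayPot_spec hL hu).2.2.2.2.2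

/-- The Leray part is the Leray projection in `L²(cell)`. [folklore] -/
theorem lerayProj_eq_lerayPart : lerayProj L (toCell L u) = toCell L (lerayPart hL hu) := (lerayPot_spec hL hu).2.2.1

end Leray

/-- **`H^k` bounds of the Leray part and of the gradient part** (`k = N + 1 ≥ 1`):
`‖∇_K q̂‖ ≤ C ‖u‖`, `‖P u‖ ≤ (1 + C) ‖u‖` in `W^{N+1,2}(cell)`. [cite: KatoLai1984, §4 (i)] -/
theorem exists_leray_bound (hL : 0 < L) (N : ℕ) : ∃ C : ℝ≥0, ∀ {u : ℝ³ → ℝ³} (hu : IsSmoothPeriodic L u),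
    eSobolevDomainNorm (N + 1) 2 (cylinderCell L) volume (cylGrad (lerayPot hL hu)) ≤
        C * eSobolevDomainNorm (N + 1) 2 (cylinderCell L) volume u ∧
      eSobolevDomainNorm (N + 1) 2 (cylinderCell L) volume (lerayPart hL hu) ≤
        (1 + C) * eSobolevDomainNorm (N + 1) 2 (cylinderCell L) volume u := by
  obtain ⟨C₀, hC₀⟩ := periodicCylinder_neumannEstimate_all L hL N
  obtain ⟨Cd, hCd⟩ := eSobolevDomainNorm_divergence_le L N
  obtain ⟨Cg, hCg⟩ := exists_eSobolevDomainNorm_inner_horizontalProj_le L (N + 1)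
  refine ⟨C₀ * (Cd + Cg), fun {u} hu => ?_⟩
  have hqs := isSmoothPeriodic_lerayPot hL hu
  obtain ⟨hlap, hneu⟩ := neumann_of_leray hu hqs (divergence_lerayPart hL hu) (slip_lerayPart hL hu)
  have hcell : (cylinderCell L : Set ℝ³) ⊆ 𝕂 := fun x hx => subset_closure (cylinderCell_le_unitCylinder L hx)
  have hGs : IsSmoothPeriodic L fun x => ⟪u x, horizontalProj x⟫ :=
    ⟨ContDiffOn.inner ℝ hu.smooth contDiff_horizontalProj.contDiffOn, fun x => by
      simp only [hu.periodic x, horizontalProj_add_axialShift]⟩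
  have hmain := hC₀ (lerayPot hL hu) (fun x => ⟪u x, horizontalProj x⟫) hqs.smooth hGs.smooth hqs.periodic hGs.periodic hneu
  have hΔ : eSobolevDomainNorm N 2 (cylinderCell L) volume (Δ (lerayPot hL hu)) =
      eSobolevDomainNorm N 2 (cylinderCell L) volume (VectorCalculus.divergence u) := by
    rw [eSobolevDomainNorm_laplacian_eq_cylLap L N hqs.smooth]
    exact SobolevApprox.eSobolevDomainNorm_congr (Ω := cylinderCell L) (p := 2) (μ := volume) fun x hx =>
      hlap x (cylinderCell_le_unitCylinder L hx)
  have hQbound : eSobolevDomainNorm (N + 1) 2 (cylinderCell L) volume (cylGrad (lerayPot hL hu)) ≤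
      (C₀ * (Cd + Cg) : ℝ≥0) * eSobolevDomainNorm (N + 1) 2 (cylinderCell L) volume u := by
    rw [← eSobolevDomainNorm_gradient_eq_cylGrad L (N + 1) hqs.smooth]
    refine hmain.trans ?_
    rw [hΔ, ENNReal.coe_mul, ENNReal.coe_add, mul_assoc, add_mul]
    exact mul_le_mul' le_rfl (add_le_add (hCd (hu.smooth.mono hcell)) (hCg hu.smooth))
  refine ⟨hQbound, ?_⟩
  have hm1 : AEStronglyMeasurable u (volume.restrict (cylinderCell L : Set ℝ³)) :=
    (hu.continuousOn.mono hcell).aestronglyMeasurable (cylinderCell L).isOpen.measurableSet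
  have hm2 : AEStronglyMeasurable (fun x => (-1 : ℝ) • cylGrad (lerayPot hL hu) x) (volume.restrict (cylinderCell L : Set ℝ³)) :=
    ((hqs.cylGrad.continuousOn.mono hcell).aestronglyMeasurable (cylinderCell L).isOpen.measurableSet).const_smul (-1 : ℝ)
  have e1 : lerayPart hL hu = fun x => u x + (-1 : ℝ) • cylGrad (lerayPot hL hu) x := by
    funext x; rw [lerayPart, neg_one_smul, sub_eq_add_neg]
  rw [e1]
  refine (SobolevApprox.eSobolevDomainNorm_add_le (Ω := cylinderCell L) (p := 2) (μ := volume) (k := N + 1) hm1 hm2 one_le_two).trans ?_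
  rw [add_mul, one_mul]
  refine add_le_add le_rfl ?_
  refine (eSobolevDomainNorm_const_smul_le (N + 1) (-1 : ℝ) ((contDiffOn_cylGrad hqs.smooth).mono hcell)).trans ?_
  rw [nnnorm_neg, nnnorm_one, ENNReal.coe_one, one_mul]
  exact hQbound

/-! ### The convective term and the pressure -/

section Pressure

variable (hL : 0 < L) {u : ℝ³ → ℝ³} (hu : IsSmoothPeriodic L u)

/-- **The convective term** `(w·∇_K)w`, `w = P u`. [cite: KatoLai1984, §4 (4.1), §5 (5.6)] -/
def convTerm : ℝ³ → ℝ³ := cylDeriv (lerayPart hL hu) (lerayPart hL hu)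

/-- The convective term is smooth periodic. [folklore] -/
theorem isSmoothPeriodic_convTerm : IsSmoothPeriodic L (convTerm hL hu) :=
  isSmoothPeriodic_cylDeriv (isSmoothPeriodic_lerayPart hL hu) (isSmoothPeriodic_lerayPart hL hu)

/-- **The pressure potential** `π`: the Helmholtz potential of `(w·∇_K)w`, `∇_K π = Q((w·∇_K)w)`.
[cite: KatoLai1984, §5 (5.6)] -/
def pressurePot : ℝ³ → ℝ := lerayPot hL (isSmoothPeriodic_convTerm hL hu)

/-- **The pressure gradient** `∇_K π = Q((w·∇_K)w)`. [cite: KatoLai1984, §5 (5.6)] -/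
def pressureGrad : ℝ³ → ℝ³ := cylGrad (pressurePot hL hu)

/-- The pressure potential is smooth periodic. [folklore] -/
theorem isSmoothPeriodic_pressurePot : IsSmoothPeriodic L (pressurePot hL hu) :=
  isSmoothPeriodic_lerayPot hL (isSmoothPeriodic_convTerm hL hu)

/-- The pressure gradient is smooth periodic. [folklore] -/
theorem isSmoothPeriodic_pressureGrad : IsSmoothPeriodic L (pressureGrad hL hu) :=
  (isSmoothPeriodic_pressurePot hL hu).cylGrad

/-- **The Neumann problem of the pressure, interior equation**: `Δ_K π = ∑ᵢⱼ (∂ᵢw)ⱼ(∂ⱼw)ᵢ` in the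
open cylinder. [cite: Temam1975, §1] -/
theorem cylLap_pressurePot_eq {x : ℝ³} (hx : x ∈ (unitCylinder : Set ℝ³)) :
    cylLap (pressurePot hL hu) x = gradSqTrace (lerayPart hL hu) x := by
  have hv := isSmoothPeriodic_convTerm hL hu
  obtain ⟨hlap, -⟩ := neumann_of_leray hv (isSmoothPeriodic_lerayPot hL hv) (divergence_lerayPart hL hv) (slip_lerayPart hL hv)
  rw [pressurePot, hlap x hx, convTerm]
  exact divergence_cylDeriv_self_of_divFree (isSmoothPeriodic_lerayPart hL hu).smooth (divergence_lerayPart hL hu) hx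

/-- **The Neumann problem of the pressure, boundary datum**: `∂π/∂n = −|w_h|²` on the wall.
[cite: Temam1975, §1] -/
theorem neumann_pressurePot_eq {x : ℝ³} (hx : x ∈ frontier (unitCylinder : Set ℝ³)) :
    fderivWithin ℝ (pressurePot hL hu) 𝕂 x (eR x) = -‖horizontalProj (lerayPart hL hu x)‖ ^ 2 := by
  have hv := isSmoothPeriodic_convTerm hL hu
  obtain ⟨-, hneu⟩ := neumann_of_leray hv (isSmoothPeriodic_lerayPot hL hv) (divergence_lerayPart hL hv) (slip_lerayPart hL hv)
  rw [pressurePot, hneu x hx, convTerm]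
  exact inner_cylDeriv_self_horizontalProj_of_wall (isSmoothPeriodic_lerayPart hL hu).smooth (slip_lerayPart hL hu) hx

end Pressure

/-! ### The tame pressure estimate -/

/-- **The tame pressure estimate** (Kato–Lai's (4.4) with `P` inserted, `s₀ = 3`): for `L > 0`
and `m ≥ 1` there is `C` with
`‖∇_K π‖_{W^{m,2}(cell)} ≤ C ‖u‖_{W^{3,2}(cell)} ‖u‖_{W^{m,2}(cell)}` for every smooth periodic `u`.
[cite: KatoLai1984, §4 (4.4)] -/
theorem exists_pressureGrad_le (hL : 0 < L) {m : ℕ} (hm : 1 ≤ m) : ∃ C : ℝ≥0,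
    ∀ {u : ℝ³ → ℝ³} (hu : IsSmoothPeriodic L u),
      eSobolevDomainNorm m 2 (cylinderCell L) volume (pressureGrad hL hu) ≤
        C * eSobolevDomainNorm 3 2 (cylinderCell L) volume u * eSobolevDomainNorm m 2 (cylinderCell L) volume u := by
  obtain ⟨N, rfl⟩ : ∃ N, m = N + 1 := ⟨m - 1, by omega⟩
  obtain ⟨C₀, hC₀⟩ := periodicCylinder_neumannEstimate_all L hL N
  obtain ⟨C₁, hC₁0, hC₁⟩ := exists_eSobolevDomainNorm_gradSqTrace_le hL N
  obtain ⟨C₂, hC₂0, hC₂⟩ := exists_eSobolevDomainNorm_horizSq_le hL (N + 1)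
  obtain ⟨C₃, hC₃⟩ := exists_leray_bound hL 2
  obtain ⟨Cm, hCm⟩ := exists_leray_bound hL N
  refine ⟨C₀ * (Real.toNNReal C₁ + Real.toNNReal C₂) * ((1 + C₃) * (1 + Cm)), fun {u} hu => ?_⟩
  set w := lerayPart hL hu with hwdef
  have hw : IsSmoothPeriodic L w := isSmoothPeriodic_lerayPart hL hu
  have hπ := isSmoothPeriodic_pressurePot hL hu
  -- the Neumann datum
  set G : ℝ³ → ℝ := fun x => -‖horizontalProj (w x)‖ ^ 2 with hG
  have hHs : ContDiffOn ℝ ∞ (fun x => ‖horizontalProj (w x)‖ ^ 2) 𝕂 :=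
    (contDiff_horizontalProj.comp_contDiffOn hw.smooth).norm_sq ℝ
  have hGs : IsSmoothPeriodic L G :=
    ⟨hHs.neg, fun x => by simp only [hG, hw.periodic x]⟩
  have hmain := hC₀ (pressurePot hL hu) G hπ.smooth hGs.smooth hπ.periodic hGs.periodic
    (fun x hx => neumann_pressurePot_eq hL hu hx)
  -- the Laplacian on the cell
  have hΔ : eSobolevDomainNorm N 2 (cylinderCell L) volume (Δ (pressurePot hL hu)) =
      eSobolevDomainNorm N 2 (cylinderCell L) volume (gradSqTrace w) := by
    rw [eSobolevDomainNorm_laplacian_eq_cylLap L N hπ.smooth]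
    exact SobolevApprox.eSobolevDomainNorm_congr (Ω := cylinderCell L) (p := 2) (μ := volume) fun x hx =>
      cylLap_pressurePot_eq hL hu (cylinderCell_le_unitCylinder L hx)
  -- the datum on the cell
  have hcell : (cylinderCell L : Set ℝ³) ⊆ 𝕂 := fun x hx => subset_closure (cylinderCell_le_unitCylinder L hx)
  have hGb : eSobolevDomainNorm (N + 1) 2 (cylinderCell L) volume G ≤
      eSobolevDomainNorm (N + 1) 2 (cylinderCell L) volume (fun x => ‖horizontalProj (w x)‖ ^ 2) := by
    have e : G = fun x => (-1 : ℝ) • ‖horizontalProj (w x)‖ ^ 2 := by funext x; rw [hG]; simp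
    rw [e]
    refine (eSobolevDomainNorm_const_smul_le (N + 1) (-1 : ℝ) (hHs.mono hcell)).trans ?_
    rw [nnnorm_neg, nnnorm_one, ENNReal.coe_one, one_mul]
  -- abbreviations
  set U3 := eSobolevDomainNorm 3 2 (cylinderCell L) volume u
  set Um := eSobolevDomainNorm (N + 1) 2 (cylinderCell L) volume u
  set W3 := eSobolevDomainNorm 3 2 (cylinderCell L) volume w
  set Wm := eSobolevDomainNorm (N + 1) 2 (cylinderCell L) volume w
  have hW3 : W3 ≤ (1 + C₃) * U3 := (hC₃ hu).2
  have hWm : Wm ≤ (1 + Cm) * Um := (hCm hu).2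
  have hW2 : eSobolevDomainNorm 2 2 (cylinderCell L) volume w ≤ W3 := eSobolevDomainNorm_le_succ
  have h1 : eSobolevDomainNorm N 2 (cylinderCell L) volume (gradSqTrace w) ≤ ENNReal.ofReal C₁ * W3 * Wm := hC₁ w hw
  have h2 : eSobolevDomainNorm (N + 1) 2 (cylinderCell L) volume (fun x => ‖horizontalProj (w x)‖ ^ 2) ≤
      ENNReal.ofReal C₂ * W3 * Wm :=
    (hC₂ w hw).trans (mul_le_mul' (mul_le_mul' le_rfl hW2) le_rfl)
  have hWW : W3 * Wm ≤ ((1 + C₃) * (1 + Cm) : ℝ≥0) * (U3 * Um) := by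
    calc W3 * Wm ≤ ((1 + C₃) * U3) * ((1 + Cm) * Um) := mul_le_mul' hW3 hWm
      _ = ((1 + C₃) * (1 + Cm) : ℝ≥0) * (U3 * Um) := by push_cast; ring
  calc eSobolevDomainNorm (N + 1) 2 (cylinderCell L) volume (pressureGrad hL hu)
      = eSobolevDomainNorm (N + 1) 2 (cylinderCell L) volume (gradient (pressurePot hL hu)) := by
        rw [pressureGrad, eSobolevDomainNorm_gradient_eq_cylGrad L (N + 1) hπ.smooth]
    _ ≤ C₀ * (eSobolevDomainNorm N 2 (cylinderCell L) volume (Δ (pressurePot hL hu)) +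
          eSobolevDomainNorm (N + 1) 2 (cylinderCell L) volume G) := hmain
    _ ≤ C₀ * (ENNReal.ofReal C₁ * W3 * Wm + ENNReal.ofReal C₂ * W3 * Wm) := by
        rw [hΔ]; exact mul_le_mul' le_rfl (add_le_add h1 (hGb.trans h2))
    _ = C₀ * (ENNReal.ofReal C₁ + ENNReal.ofReal C₂) * (W3 * Wm) := by ring
    _ ≤ C₀ * (ENNReal.ofReal C₁ + ENNReal.ofReal C₂) * (((1 + C₃) * (1 + Cm) : ℝ≥0) * (U3 * Um)) :=
        mul_le_mul' le_rfl hWW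
    _ = (C₀ * (Real.toNNReal C₁ + Real.toNNReal C₂) * ((1 + C₃) * (1 + Cm)) : ℝ≥0) * U3 * Um := by
        rw [ENNReal.ofReal, ENNReal.ofReal]
        push_cast
        ring

end PeriodicCylinder

end Literature.Analysis.FluidPDE
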